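import Literature.AlgebraicGeometry.HodgeTheory.ThetaMapHyperplaneClass
import Literature.AlgebraicGeometry.HodgeTheory.ProjectiveSpaceCoordFunProjPoint
import Literature.Geometry.Kaehler.ComplexTorusLefschetzFamilyCoordinates
import Literature.Geometry.Kaehler.ComplexTorusPositiveClassSiegelFactor
import Literature.AlgebraicGeometry.AbelianVarieties.PolarisedTorusAlgebraic
import Literature.NumberTheory.Transcendental.AnalytificationUnique
import Literature.AlgebraicGeometry.Motives.AbelianVarietyProjectiveChart
import Literature.AlgebraicGeometry.Motives.AbelianVarietyDegree
import HarnessLib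

/-!
# Lefschetz: the cube of a positive line bundle on a complex abelian variety is the class of an AMPLE algebraic divisor

Layer `Literature/AlgebraicGeometry/HodgeTheory`, namespace `Literature.AlgebraicGeometry.HodgeTheory`.  THEOREMS ONLY (no
definition, no named fact, no instance).  HEAD of the cell `hodgecm-mathlib` (U)-lane node U-aΘ, leaf L4 (socket
`UaTheta_L4_ampleMultiple` of the (U)-HEAD skeleton, text verbatim in `uaTheta_L4_ampleMultiple` below).

Let `A` be a complex abelian variety uniformised by a complex torus `φ : X = ℂ^g/Φ(ℤ^ι) → A(ℂ)` (an analytification) and let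
`p = (H, χ) ∈ 𝒫(Λ)` be an Appell–Humbert datum whose form `E = Im H` is a RIEMANN FORM (positive definite).  THEN there is an
AMPLE Cartier divisor `H₃` on `A` with `[𝒪_A(H₃)^an] = L(H, χ)³` in `Pic(X)` (`exists_isAmple_picClass_eq_toPic_pow_three`);
hence «a positive power of a positive class is the class of an ample divisor» (`uaTheta_L4_ampleMultiple`, `q = 3`).

Proof (Lefschetz's theorem, Lange–Birkenhake Thm. 4.5.1 / Mumford §3, assembled from tree engines):
1. ★ `ComplexTorus.IsRiemannForm.exists_toPic_eq_translate_pullback_siegelFactor`: an isomorphism `f = (P, F)` of `X` with a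
   Siegel torus `X_{(Ω,D)}` of the type of `E` and a vector `u` with `L(H, χ) = t_ū^* f^*[e[0;0]]` — so the level-three theta
   functions `f_k` of type `D` (★ `exists_lefschetz_levelThree_family_typeD_of_posDef`), read on `X` as `g_k(v) = f_k(F(v + u))`,
   form a Lefschetz family with common factor `e[0;0](Pλ, F(v + u))³`, whose class is `L(H, χ)³`;
2. ★ `ComplexTorus.exists_embedding_of_lefschetzFamily_eq_mk`: `π(v) ↦ [g_k(v)]_k` is an injective holomorphic immersion
   `F_A : X → ℙᴺ(ℂ)`;
3. ★ `AbelianVarieties.exists_smoothProjective_of_projectiveEmbedding` (Chow + GAGA) algebraises its image to a smooth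
   projective `X' ⊆ ℙᴺ_ℂ` analytified by `X`, and ★ `exists_iso_of_isAnalytification` (uniqueness of algebraic structure, with
   ★ `AbelianVariety.isSmoothProjective_holds`) identifies `A.X ≅ X'`, giving a closed immersion `Ψ : A → ℙᴺ_ℂ` with
   `Ψ(ℂ) ∘ φ = projPoint ∘ F_A`;
4. the hyperplane divisor `H₃ = (Ψ^*x_{k₀})` is ample (★ `GeneratingSections.isAmple_divisor`, Görtz–Wedhorn I Prop. 13.47) and
   `[𝒪_A(H₃)^an] = ⟦e[0;0](Pλ, F(v + u))³⟧ = L(H, χ)³` (★ `picClass_cartierDivisorLineBundle_divisor_eq_toPic`, its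
   `hdom`/`hcoord` read off `projPoint` by ★ `mem_chartDom_id_projPoint_mk_iff` / ★ `coordFun_id_projPoint_mk`).
HC_CM is proved only modulo the 7 printed citations until rung 0 closes.

## References
* [LangeBirkenhake1992] H. Lange, Ch. Birkenhake, *Complex Abelian Varieties* (1992), Thm. 4.5.1 (Lefschetz) and §8.1 Prop. 8.1.1.
* [MumfordAV1970] D. Mumford, *Abelian Varieties* (1970), §3 (Theorem of Lefschetz), pp. 29–33.
* [Lange2023AbelianVarietiesComplex] H. Lange, *Abelian Varieties over the Complex Numbers* (2023), §2.1.3 Thm. 2.1.10 and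
  Prop. 2.1.11 (pp. 79–80), §1.2.1 Prop. 1.2.2–1.2.3 (pp. 21–22).
* [GortzWedhorn2020] U. Görtz, T. Wedhorn, *Algebraic Geometry I* (2nd ed. 2020), Prop. 13.47 (pp. 392–393).
-/

noncomputable section

open scoped Manifold ContDiff Topology LinearAlgebra.Projectivization Real
open CategoryTheory AlgebraicGeometry Complex
open Literature.AlgebraicGeometry.Motives Literature.AlgebraicGeometry.Motives.AlgPoints
  Literature.AlgebraicGeometry.Motives.AnalytificationKaehler
  Literature.NumberTheory.Transcendental Literature.Geometry.Kaehler Literature.Geometry.Kaehler.ComplexTorus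
  Literature.Analysis.SpecialFunctions

namespace Literature.AlgebraicGeometry.HodgeTheory

/-- **Lefschetz's theorem, `Pic`-level form: `L(H, χ)³ = [𝒪_A(H₃)^an]` for an AMPLE algebraic divisor `H₃`.**  For a
complex abelian variety `A` uniformised by `φ : ℂ^g/Φ(ℤ^ι) → A(ℂ)` and an Appell–Humbert datum `p = (H, χ)` with `Im H` a
Riemann form, some ample Cartier divisor on `A` has analytified line bundle of class `(AHData.toPic p)³`.
[cite: LangeBirkenhake1992, Thm. 4.5.1] [cite: MumfordAV1970, §3 pp. 29–33]
[cite: Lange2023AbelianVarietiesComplex, §2.1.3 Thm. 2.1.10 and Prop. 2.1.11 (pp. 79–80)] [cite: GortzWedhorn2020, Prop. 13.47 (pp. 392–393)] -/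
theorem exists_isAmple_picClass_eq_toPic_pow_three (A : AbelianVariety ℂ) (ι : Type) [Fintype ι] [DecidableEq ι]
    (Φ : (ι → ℝ) ≃L[ℝ] (Fin A.dim → ℂ)) (φ : ComplexTorus Φ → ComplexPoints A.X)
    (hφ : IsAnalytification (Fin A.dim → ℂ) A.X A.dim φ) (p : AHData Φ) (hp : IsRiemannForm Φ p.form) :
    ∃ H : CartierDivisor A.X.left, H.IsAmple ∧ picClass (cartierDivisorLineBundle hφ H) = AHData.toPic p ^ 3 := by
  classical
  /- Step 1: `L(H, χ) = t_ū^* f^* [e[0;0]]` for an isomorphism with a Siegel torus of type `D`. -/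
  obtain ⟨g, d, Ω, Φ', P, Q, F, G, hΩ, hΦ', hPF, u, hd, hpos, hPQ, hQP, hGF, hFG, -, hclass⟩ :=
    ComplexTorus.IsRiemannForm.exists_toPic_eq_translate_pullback_siegelFactor Φ p hp
  set t : Factor Φ := Factor.translate Φ u
    (Factor.pullback Φ Φ' hPF ⟨siegelFactor Ω, isFactor_siegelFactor_typeD Ω d Φ' hΦ' hΩ⟩) with ht
  have ht_apply : ∀ l v, t l v = siegelFactor Ω (P.mulVec l) (F (v + u)) := fun l v ↦ rfl
  /- the level-three theta functions of type `D` on the Siegel side -/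
  obtain ⟨f, hfd, hper, hqper, hbpf, hinj, himm⟩ := exists_lefschetz_levelThree_family_typeD_of_posDef Ω hΩ hpos d hd
  -- their quasi-periodicity along `Dℤ^g ⊕ Ωℤ^g`, factor `e[0;0]³`
  have hquasi : ∀ k (w : Fin g ⊕ Fin g → ℤ) (z : Fin g → ℂ),
      f k (z + ComplexTorus.latticeVec Φ' w) = siegelFactor Ω w z ^ 3 * f k z := by
    intro k w z
    set m : Fin g → ℤ := fun i ↦ w (Sum.inl i) with hm
    set n' : Fin g → ℤ := fun j ↦ w (Sum.inr j) with hn'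
    have hz : z + ComplexTorus.latticeVec Φ' w =
        fun i ↦ (fun i ↦ z i + ∑ j, Ω i j * (n' j : ℂ)) i + (d i : ℂ) * (m i : ℂ) := by
      funext i
      rw [Pi.add_apply, latticeVec_siegel_typeD Ω d Φ' hΦ' w i]
      simp only [hm, hn']
      ring
    rw [hz, hper, hqper, siegelFactor_apply, ← Complex.exp_nat_mul]
    push_cast
    simp only [hn']
  /- Step 2: the Lefschetz family `g_k(v) = f_k(F(v + u))` on `X` and its common factor `t³`. -/
  have hgq : ∀ k (l : ι → ℤ) (v : Fin A.dim → ℂ),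
      f k (F (v + ComplexTorus.latticeVec Φ l + u)) = t l v ^ 3 * f k (F (v + u)) := by
    intro k l v
    rw [ht_apply, add_right_comm, map_add, ComplexTorus.apply_latticeVec_eq Φ Φ' hPF, hquasi]
  have hgd : ∀ k, Differentiable ℂ (fun v : Fin A.dim → ℂ ↦ f k (F (v + u))) := fun k ↦
    (hfd k).comp (F.differentiable.comp (differentiable_id.add_const u))
  obtain ⟨N, σ, FA, hFAs, hFAi, hFAm, hFAc⟩ := ComplexTorus.exists_embedding_of_lefschetzFamily_eq_mk Φ
    (fun k v ↦ f k (F (v + u))) hgd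
    (fun v l ↦ ⟨t l v ^ 3, fun k ↦ hgq k l v⟩)
    (fun v ↦ hbpf (F (v + u)))
    (by
      intro z₁ z₂ γ hγ
      obtain ⟨m, n', hmn⟩ := hinj (F (z₁ + u)) (F (z₂ + u)) γ hγ
      refine ⟨Q.mulVec (Sum.elim m n'), ?_⟩
      have hsub : F (z₂ + u) - F (z₁ + u) = ComplexTorus.latticeVec Φ' (Sum.elim m n') := by
        funext i
        rw [Pi.sub_apply, hmn i, latticeVec_siegel_typeD Ω d Φ' hΦ']
        simp only [Sum.elim_inl, Sum.elim_inr]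
      have hF' : F (z₂ - z₁) = F (ComplexTorus.latticeVec Φ (Q.mulVec (Sum.elim m n'))) := by
        rw [ComplexTorus.apply_latticeVec_eq Φ Φ' hPF, Matrix.mulVec_mulVec, hPQ, Matrix.one_mulVec, ← hsub,
          ← map_sub, add_sub_add_right_eq_sub]
      have hG' := congrArg G hF'
      rw [hGF, hGF] at hG'
      rw [← hG', add_sub_cancel])
    (by
      intro z v μ hv
      have hderiv : ∀ k, fderiv ℂ (fun x : Fin A.dim → ℂ ↦ f k (F (x + u))) z v = fderiv ℂ (f k) (F (z + u)) (F v) := by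
        intro k
        have h1 : HasFDerivAt (fun x : Fin A.dim → ℂ ↦ F (x + u)) F z := by
          have h := F.hasFDerivAt.comp z ((hasFDerivAt_id z).add_const u)
          rwa [ContinuousLinearMap.comp_id] at h
        have h2 : HasFDerivAt (fun x : Fin A.dim → ℂ ↦ f k (F (x + u)))
            ((fderiv ℂ (f k) (F (z + u))).comp F) z :=
          ((hfd k) (F (z + u))).hasFDerivAt.comp z h1
        rw [h2.fderiv]
        rfl
      have hFv : F v = 0 := himm (F (z + u)) (F v) μ fun k ↦ by rw [← hderiv k]; exact hv k
      have := congrArg G hFv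
      rwa [hGF, map_zero] at this)
  /- Step 3: algebraise the image and identify it with `A`. -/
  obtain ⟨X', ι', hι', hX'red, ψ, hψ, hcomp, hX'⟩ :=
    Literature.AlgebraicGeometry.AbelianVarieties.exists_smoothProjective_of_projectiveEmbedding FA hFAs hFAi hFAm
  obtain ⟨e, he, -⟩ := exists_iso_of_isAnalytification
    (AbelianVariety.isSmoothProjective_holds (A := A)) hX' hφ hψ
  set Ψ : A.X ⟶ projectiveSpace N ℂ := e.hom ≫ ι' with hΨ
  have hmap : ∀ x, projPoint N (FA x) = AlgPoints.map Ψ (φ x) := fun x ↦ by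
    rw [hΨ, AlgPoints.map_comp_apply, ← he x, hcomp x]
  haveI : IsIso e.hom.left := ((Over.forget _).mapIso e).isIso_hom
  haveI : IsClosedImmersion Ψ.left := by
    change IsClosedImmersion (e.hom.left ≫ ι'.left)
    infer_instance
  /- Step 4: the hyperplane divisor `H₃ = (Ψ^* x_{k₀})` is ample and has class `⟦t³⟧ = L(H, χ)³`. -/
  obtain ⟨k₀, hk₀⟩ := (GeneratingSections.affineChartData Ψ).exists_mem_U (genericPoint A.X.left)
  refine ⟨(GeneratingSections.affineChartData Ψ).divisor k₀ hk₀,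
    (GeneratingSections.affineChartData Ψ).isAmple_divisor k₀ hk₀
      (GeneratingSections.isAffineOpen_affineChartData_U Ψ), ?_⟩
  -- the homogeneous coordinates of `Ψ(ℂ) ∘ φ ∘ π` are the `g_k`
  have hne : ∀ v : Fin A.dim → ℂ, (fun j ↦ f (σ j) (F (v + u))) ≠ 0 := by
    intro v h0
    obtain ⟨k, hk⟩ := hbpf (F (v + u))
    exact hk (by simpa using congrFun h0 (σ.symm k))
  have hdom : ∀ c v, ComplexTorus.cover Φ v ∈ chartDom Ψ φ c ↔ f (σ c) (F (v + u)) ≠ 0 := by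
    intro c v
    rw [mem_chartDom_iff_comp Ψ φ (projPoint N) FA hmap c, hFAc v (hne v)]
    exact mem_chartDom_id_projPoint_mk_iff N _ (hne v) c
  have hcoord : ∀ c d' v, ComplexTorus.cover Φ v ∈ chartDom Ψ φ d' →
      coordFun Ψ φ d' (ComplexTorus.cover Φ v) c = f (σ c) (F (v + u)) / f (σ d') (F (v + u)) := by
    intro c d' v hv
    rw [coordFun_eq_coordFun_id_comp Ψ φ (projPoint N) FA hmap d', Function.comp_apply, hFAc v (hne v)]
    exact coordFun_id_projPoint_mk N _ ((hdom d' v).1 hv) (hne v) c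
  have hθe : ∀ c (l : ι → ℤ) v, f (σ c) (F (v + ComplexTorus.latticeVec Φ l + u)) =
      (t ^ 3) l v * f (σ c) (F (v + u)) := by
    intro c l v
    rw [hgq, pow_three', pow_three', Factor.mul_apply, Factor.mul_apply]
  have key := picClass_cartierDivisorLineBundle_divisor_eq_toPic hφ Ψ k₀ hk₀ (t ^ 3).isFactor
    (fun c v ↦ f (σ c) (F (v + u))) (fun c ↦ hgd (σ c)) hθe hdom hcoord
  rw [key, hclass, ← map_pow Factor.toPic t 3]

/-- **U-aΘ L4 (the cell's socket `UaTheta_L4_ampleMultiple`, text verbatim)**: «a positive power of a POSITIVE class is the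
class of an AMPLE divisor», with `q = 3`; the group-law compatibility `_hadd` of the uniformisation is not needed.
[cite: LangeBirkenhake1992, Thm. 4.5.1] [cite: MumfordAV1970, §3 pp. 29–33]
[cite: Lange2023AbelianVarietiesComplex, §2.1.3 Thm. 2.1.10 and Prop. 2.1.11 (pp. 79–80)] -/
theorem uaTheta_L4_ampleMultiple :
    ∀ (A : AbelianVariety ℂ) (ι : Type) [Fintype ι] [DecidableEq ι] (Φ : (ι → ℝ) ≃L[ℝ] (Fin A.dim → ℂ))
      (φ : ComplexTorus Φ → ComplexPoints A.X) (hφ : IsAnalytification (Fin A.dim → ℂ) A.X A.dim φ)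
      (_hadd : ∀ x y, φ (x + y) = φ x * φ y) (p : AHData Φ),
      Literature.Geometry.Kaehler.ComplexTorus.IsRiemannForm Φ p.form →
        ∃ q : ℕ, 0 < q ∧ ∃ H : CartierDivisor A.X.left,
          H.IsAmple ∧ picClass (cartierDivisorLineBundle hφ H) = AHData.toPic p ^ q :=
  fun A ι _ _ Φ φ hφ _ p hp ↦ ⟨3, by norm_num, exists_isAmple_picClass_eq_toPic_pow_three A ι Φ φ hφ p hp⟩

end Literature.AlgebraicGeometry.HodgeTheory

end
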